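import Literature.MathematicalPhysics.QuantumFieldTheory.Balaban1983to89.Node00.N24KnitStage13AllCoPR
import Literature.MathematicalPhysics.QuantumFieldTheory.Balaban1983to89.B16RLeafRecord13LiveCoPR
import Literature.MathematicalPhysics.QuantumFieldTheory.Balaban1983to89.Node00.Record13LiveSelector

/-!
# NODE N24 · THE CLOSER'S POINTED FORMS AT A CORE-KEYED Co STAGE-13 PRESENTATION ON THE LIVE-SELECTOR LINE — N13's 𝐑-HALF (R₁₃) IS A THEOREM THERE (seat dag-n11-e's (D) chain
# `B16RLeafRecord13LiveCoPR.laws₁₃CoPR_of_liveSel_of_rstep` fed by the CORE-keyed row `hP.rstep`: at any `θ : Stage13Params` carrying the live-selector clause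
# `θ.ppSel = ppSelLiveOfRecord … (EOfRecord₁₃ θ) …`, from the provisos, admissibility and the term-constant signs ALONE — 𝐑 of record = identity a.e.), and at node00-def-K0a's live
# re-pin `θ.liveRepin₁₃` where the clause holds by `rfl` (`Stage13Params.liveRepin₁₃_ppSel`) — module 39 (‴ `N24NodesStage13PointedAtLive` p492635, ⁗ `N24NodesStage13PointedAtLiveSep`
# p506063) STATED ONCE OVER `Provisos₁₃CoPR ∕ datumOfRecord₁₃CoPR ∕ IsRecordOfRecord₁₃CCoPR` (node00-def-T FILE 25 `Node00/Record13CoPR.lean`, v1.6)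

TRACK A (YM-PLAN §2d, node N24 of 28 = binder B2 `hB : B16.EndStatementBPrinted D.C`), seat `pub-ymgap-dag-n24-c` (R134 fan-out seat, strategy s2; gen 5).
THE v1.6 `CoPR` EDITION (director-ym №169 ∕ №174 after FINDING №8 — node00-def-T LOCATED-8: the 𝐓-residual slot `Zt : (K : ℕ) → …` was RUN-BLIND; H1 = `structure Stage13RParams extends Stage13Params` + the RUN-INDEXED residual `Zr : (p : B12.RunParams) → TkResidualW … p.K`, core key `Stage13RParams.Provisos₁₃CoPR` (= `Provisos₁₃Core`'s rows at `θ.toStage13Params` + `zrLaws ∕ zrLocal`), every background-free object read at `θ.toStage13Params`; node00-def-T FILE 25 `Node00/Record13CoPR.lean` + 26T `Node00/Record13SepCoPR.lean`, keymap `keymap-CoPR.tsv`; = this seat's LANDED v1.5 CoP edition under that keymap, proofs verbatim) — RECORD 13 AT PRINT's BACKGROUND `UbgOfRecord₁₃CoPR` (node00-def-R `UbgMSCoPOfRecord` over [15] p.277's Ω₀ = Ω₁ + M₁-collar, FILE 22′ p519921) WITH PRINT's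
ζ0-ONLY 𝐓-WEIGHTS `WtOfRecord₁₃R` (node00-def-T 12a″ `TkWeightsOfRecordP` p519608) — director-ym LINE №152 (β) + №160 F7 ∕ №162 (y) after FINDING №7 (n11-d `not_tLaw₁₃_zero`:
on ≤ v1.4 the (S1ᵀ) slot `SLaw → TLaw` of every hT-face was unsatisfiable at k = 0 via 12a's `chiRegW` on `Ω₁ᶜ`; F7 re-ranges that weight — satisfiability at k = 0 is NOT asserted here);
node00-def-T FILE 25 `Node00/Record13CoPR.lean` p529474, KEY = `keymap-CoPR.tsv`; = this seat's LANDED v1.5 CoP edition p522217 ∕ p522487 ∕ p523453 ∕ p524607 ∕ p524398 (∕ thin p525276 ∕ p526035 ∕ PinX3HS p529950) under the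
keymap, proofs verbatim — AND EDITION-FREE OVER THE PROVISO EDITIONS (def-T ∕ №152 §4 «key ONCE, on Core(Co), where you read no
proviso row»).  N24's Stage-13 surface (modules 37–44: ‴ v1.1-keyed, ⁗ v1.2 `Sep`-keyed, the ⁵ `SepMixed` prestage — all at the tree's former background `UbgOfRecord₁₃`) reads NO proviso
row of node00-def-T's RECORD 13 except the CORE rows `rstep` ∕ `tstep` (through the datum, and on the live line to feed dag-n11-e's (D) chain and node00-def-K0a's slots lemma); hence
every NON-item-facing theorem is stated ONCE here, over the background-free core key `Stage13RParams.Provisos₁₃CoPR` (UNCHANGED, `Node00/Record13.lean` v1.2 §9) and def-T's Co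
objects of record — laws `SLaw₁₃CoPR ∕ TLaw₁₃CoPR`, 𝐑-carrier `VOfRecord₁₃CoPR`, Stage-5 view `Stage13RParams.toStage5₁₃CoPR`, machine core `coreOfRecord₁₃CoPR`, tower ∕ datum
`towerOfRecord₁₃CoPR ∕ datumOfRecord₁₃CoPR (θ) (h : θ.Provisos₁₃CoPR F N)`, the bg-free Co RECORD FAMILY `IsRecordOfRecord₁₃CCoPR` with its pointed form, shadow ∕ transfer block and
`endStatementBPrinted_of_isRecordOfRecord₁₃CCoPR_of_nodes` (FILE 25; the density `densOfRecord₁₃`, the histories `gOfRecord₁₃`, `betaOfRecord₁₃`, `EOfRecord₁₃`, the (2.9) species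
`chiβOfRecord₁₃` and `wilsonBGOfRecord` are background-FREE and unchanged) — and serves EVERY proviso edition E over that background (v1.6 `Provisos₁₃SepCoPR` — def-T FILE 26T
`Node00/Record13SepCoPR.lean` — and its successors) AT `hP.toCore` (def-T's one-way map `Provisos₁₃E.toCore`, record projection `IsRecordOfRecord₁₃CE.toCoPR`; datum bridge
`datumOfRecord₁₃E F N θ h = datumOfRecord₁₃CoPR F N θ h.toCore` by `rfl`).  Only the ITEM-FACING theorems — K1's θ-keyed consequent `∃ θ' (h' : θ'.Provisos₁₃E F N), …` and the
registered rung bodies concluding `IsRecordOfRecord₁₃CE …` — stay per edition, in ONE thin module per edition whose proofs are the 3-line packagings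
`⟨θ, hP, …, <Co engine> … hP.toCore …, window⟩` of the engines below (this seat's `N24ItemsStage13SepCoPR`).  A Co record has NO background ROW (only the background OBJECT in its §2
form): on its own it discharges nothing of (B) — the (B)-side inputs are HYPOTHESES here exactly as in every edition.
A NEW importing module (imports `Node00.N24KnitStage13AllCoPR`, dag-n11-e's (D) chain at print's background `B16RLeafRecord13LiveCoPR`, node00-def-K0a's `Node00.Record13LiveSelector`).  THEOREMS ONLY, def-free,
sorry-free, standard axioms.  = module 39 §1–§2 (via its ⁗ edition) under KEY-RULE-21; §3 of module 39 (K1's θ-keyed texts) is ITEM-FACING and lives in the edition's thin module.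
BY NAME: `N24KnitStage13AllCoPR`'s `N24_nodes₁₃CoPR_pointed` ∕ `N24_endStatementBPrinted₁₃CoPR_pointed` ∕ `N24_stabilityBR13CoPR_shape_pointed`; dag-n11-e's `laws₁₃CoPR_of_liveSel_of_rstep`
(fed by `fun p k _ hk => hP.rstep p k hk` — ★ the (R₁₃) slot in LAW FORM on the live line, from `Provisos₁₃CoPR.rstep`, `Admissible`, `0 ≤ κ, E₀, B₀` and the selector clause); K0a's
`Stage13Params.liveRepin₁₃`, `liveRepin₁₃_ppSel` (`rfl`), `Admissible.liveRepin₁₃`.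

WHAT THIS FILE PROVES (4 theorems).
§1 AT ANY `θ` WITH THE LIVE-SELECTOR CLAUSE `hsel` (signs displayed): `N24_nodes₁₃CoPR_pointed_liveSel` (the thirteen nodes at a world bound to the Co presentation — N13's `hR`
   GONE), `N24_endStatementBPrinted₁₃CoPR_pointed_liveSel` ((B2) at the presentation's datum), **`N24_stabilityBR13CoPR_shape_pointed_liveSel`** (`IsRecordOfRecord₁₃CCoPR … w ∧ (B) ∧
   window`).
§2 AT K0a's LIVE RE-PIN: **`N24_stabilityBR13CoPR_shape_pointed_liveRepin₁₃`** (`hsel := liveRepin₁₃_ppSel`, `Admissible.liveRepin₁₃`; displayed: the CORE-keyed provisos AT THE RE-PIN, `θ`'s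
   signs, the world binding, N05 ∕ N06 ∕ N07 ∕ N08 ∕ N12 leaves at `θ.liveRepin₁₃.res` (= `θ.res`), N09's own leaf + Thm-3 member, N10's socket, N11's (S1ᵀ), N13's (UV₁₃), the β-box pair).
   The edition's θ-keyed consequent at the re-pin is then `⟨θ.liveRepin₁₃, hP, ⟨ZrUnity.liveRepin₁₃ hZ, slotsNondegenerate₁₃_liveRepin_of_int … hP.tstep … hP.rstep⟩, Admissible.liveRepin₁₃ hθ,
   N24_endStatementBPrinted₁₃CoPR_pointed_liveSel (⟨θ.liveRepin₁₃ F N, Zr⟩ : Stage13RParams F N) hP.toCore …, window⟩` (thin module).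

WHICH CHILD BLOCKS ON THE STAGE-13 LIVE LINE (kernel = §2's hypothesis list): the CORE-keyed provisos at the re-pin (every edition's K0-class residual yields them at `.toCore`) · the world
binding · N05 [B8] · N06 def-Y · N07 [B11] · N08 leaf-system form · N09 own leaf + Thm-3 member · N10 socket · N11 (S1ᵀ) · N12 [IV] · N13 (UV₁₃) ONLY · β⁺ ([I] (1.22) p. 264) + `b > 0`
(NODE O, UNPRINTED).
HONEST SCOPE: on the live line 𝐑 of record = identity a.e. (dag-n11-e) — [Balaban1989LargeFieldII] Thm 1's 𝐑-construction NOT exercised, N13 NOT discharged; at K0a's uniform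
residuals of record the (S1ᵀ) hypothesis is expected to FAIL (dag-n11-d's READING; this seat's LOCATED-C2-RUNS l.17289), so the concrete `theta13LiveOfRecord ∕ …OfFamily` instances are
the K1 closer's.  Kernel bookkeeping BY NAME; nothing of Bałaban's asserted; every slot DISPLAYED; N24 COMPOSITE — no discharge, no count moved (5∕27), no stub closed; one finite T⁴
programme at fixed ε; NOT continuum ∕ ℝ⁴ ∕ OS ∕ mass gap ∕ Clay.
-/

noncomputable section

open scoped Matrix.Norms.L2Operator

namespace Literature.MathematicalPhysics.QuantumFieldTheory.Balaban1983to89.Node00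

open DagBinding T4Continuum T4DatumAssembly FlowStepRuns AveragingRT
open FlowStep (BetaLowerH BetaUpperH)
open B16RLeafRecord13LiveCoPR (laws₁₃CoPR_of_liveSel_of_rstep)

variable {F : T4Family} {N : ℕ} [NeZero N]

/-! ## §1. At any Stage-13 θ carrying the live-selector clause: N13's 𝐑-half is a theorem -/

/-- **N24 · THE THIRTEEN DAG NODES AT A WORLD BOUND TO THE STAGE-13 PRESENTATION ON THE LIVE-SELECTOR LINE — N13's (R₁₃) DISCHARGED BY NAME** (module 38's
`N24_nodes₁₃CoPR_pointed` with `hR := laws₁₃_of_liveSel`). [cite: Balaban1989LargeFieldII, Thm 1 p.355 (its 𝐑-construction not exercised on this branch), (0.1) pp.355–356, p.387, p.391; Balaban1988Convergent, Thm 1 p.262, Theorem p.245, p.244, Thm 2 p.263, Cor. 3 (2.50) p.264; Balaban1989LargeFieldI, (0.3) p.176, p.177 (i)–(ii); Balaban1987RG1, Thm 3 p.264, (2.9) p.266; Balaban1985Variational, Thm 1 p.279 (node bookkeeping at the presentation)] -/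
theorem N24_nodes₁₃CoPR_pointed_liveSel (θ : Stage13RParams F N) (hP : θ.Provisos₁₃CoPR F N) (hθ : θ.Admissible F N)
    (hκ : 0 ≤ θ.s2.lf.κ) (hE₀ : 0 ≤ θ.s2.lf.E₀) (hB₀ : 0 ≤ θ.s2.lf.B₀)
    (hsel : θ.ppSel = ppSelLiveOfRecord F N θ.ν θ.τ9 (EOfRecord₁₃ F N θ.toStage13Params) (wOfRecord₉ F N θ.toStage9Params)) (w : WorldP)
    (hC : w.C = (datumOfRecord₁₃CoPR F N θ hP).C) (hγ : 0 < w.γ ∧ w.γ ≤ θ.γ) (hL : w.L = (θ.L : ℝ))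
    (hup : ∀ P, w.up P = upOfRecord₅C F N (θ.toStage5₁₃CoPR F N) P)
    (h05 : ∀ P : B12.RunParams,
      B8LeafR (θ.res.X P).d8 (θ.res.X P).L8 (θ.res.X P).C₂ (θ.res.X P).B₁' (θ.res.X P).B₀' (θ.res.X P).B₁ (θ.res.X P).B₂ (θ.res.X P).c₁
        (θ.res.X P).inp8 (θ.res.X P).B₀β (θ.res.X P).loc8 (θ.res.X P).fam8R (θ.res.X P).lan8 (θ.res.X P).cub8 (θ.res.X P).toAxial8)
    (h06 : ∀ P : B12.RunParams, B9LeafX (θ.res.Y P))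
    (h07 : ∀ P : B12.RunParams, B11Leaf (θ.res.Z P))
    (h08 : ∀ P : B12.RunParams, ∃ (Xc : PrintedCarriersR) (I : Type) (C : B10Assembly.Consts) (T : I → B10.TowerRun),
      Nonempty (∀ i, B10Assembly.LeafSystem C (T i)) ∧ θ.res.X P = Xc.withTowerRuns10 T)
    (h09 : ∀ P : B12.RunParams, B12Sec2to5.Lemma4Printed (θ.res.X P).F12 (θ.res.X P).c12)
    (h09T : ∀ P : B12.RunParams, (leavesP w P).smallCouplings → (leavesP w P).smallFieldInductive)
    (h10 : ∀ P : B12.RunParams, B9LeafX (θ.res.Y P) →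
      (B10.Thm1PrintedCompact (θ.res.X P).runs10 ∧ B10.Thm2Printed (θ.res.X P).runs10) →
        B11Leaf (θ.res.Z P) → B12Sec2to5.Lemma4Printed (θ.res.X P).F12 (θ.res.X P).c12 →
          B13.Lemma1Printed (θ.res.X P).S13 (θ.res.X P).c13 ∧ B13.Lemma2Printed (θ.res.X P).S13 (θ.res.X P).c13 ∧
            B13.Lemma3Printed (θ.res.X P).S13 (θ.res.X P).c13)
    (h11 : ∀ P : B12.RunParams, (leavesP w P).b7 → (leavesP w P).b8 → (leavesP w P).b9 → (leavesP w P).b10 → (leavesP w P).b11 →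
      (leavesP w P).smallCouplings → (leavesP w P).smallFieldInductive → (leavesP w P).flowControl →
        ∀ k, k < P.K → SLaw₁₃CoPR F N θ P k → TLaw₁₃CoPR F N θ P k)
    (h12 : ∀ P : B12.RunParams, B15Leaf (θ.res.W P))
    (hUV : ∀ P : B12.RunParams, (genFlow (betaOfRecord₁₃ F N θ.toStage13Params) P.g0).InInterval w.γ P.K → ∀ k, k ≤ P.K → SLaw₁₃CoPR F N θ P k →
      ∀ U : GaugeField (F.P P.K) k (SU N),
        chiβOfRecord₁₃ F N θ.toStage13Params P.K (gOfRecord₁₃ F N θ.toStage13Params P) k U *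
              Real.exp (-(1 / (gOfRecord₁₃ F N θ.toStage13Params P k) ^ 2 * wilsonBGOfRecord F N θ.εbg P k U)
                - w.em (gOfRecord₁₃ F N θ.toStage13Params P k) * (Fintype.card (Site (F.P P.K) k) : ℝ)) ≤ densOfRecord₁₃ F N θ.toStage13Params P k U ∧
        densOfRecord₁₃ F N θ.toStage13Params P k U ≤ Real.exp (w.ep (gOfRecord₁₃ F N θ.toStage13Params P k) * (Fintype.card (Site (F.P P.K) k) : ℝ))) :
    IsRecordOfRecord₁₃CCoPR F N (datumOfRecord₁₃CoPR F N θ hP) w ∧ ∀ P : B12.RunParams, Nodes (leavesP w P) :=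
  N24_nodes₁₃CoPR_pointed θ hP hθ w hC hγ hL hup h05 h06 h07 h08 h09 h09T h10 h11 h12 (fun P k hk => laws₁₃CoPR_of_liveSel_of_rstep F N θ P (fun p k _ hk => hP.rstep p k hk) hθ hκ hE₀ hB₀ hsel k hk) hUV

/-- **N24 · (B2) AT THE STAGE-13 PRESENTATION's DATUM ON THE LIVE-SELECTOR LINE FROM THE POINTED CHILDREN AND THE β-BOX PAIR — N13's (R₁₃) DISCHARGED BY NAME.**  COMPOSITE: nothing of Bałaban's asserted. [cite: Balaban1989LargeFieldII, Thm 1 p.355, (0.1) pp.355–356, p.391; Balaban1988Convergent, p.244, Thm 2 p.263; Balaban1989LargeFieldI, (0.3) p.176; Balaban1987RG1, (1.22) p.264 (bookkeeping)] -/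
theorem N24_endStatementBPrinted₁₃CoPR_pointed_liveSel (θ : Stage13RParams F N) (hP : θ.Provisos₁₃CoPR F N) (hθ : θ.Admissible F N)
    (hκ : 0 ≤ θ.s2.lf.κ) (hE₀ : 0 ≤ θ.s2.lf.E₀) (hB₀ : 0 ≤ θ.s2.lf.B₀)
    (hsel : θ.ppSel = ppSelLiveOfRecord F N θ.ν θ.τ9 (EOfRecord₁₃ F N θ.toStage13Params) (wOfRecord₉ F N θ.toStage9Params)) (w : WorldP)
    (hC : w.C = (datumOfRecord₁₃CoPR F N θ hP).C) (hγ : 0 < w.γ ∧ w.γ ≤ θ.γ) (hL : w.L = (θ.L : ℝ))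
    (hup : ∀ P, w.up P = upOfRecord₅C F N (θ.toStage5₁₃CoPR F N) P)
    (h05 : ∀ P : B12.RunParams,
      B8LeafR (θ.res.X P).d8 (θ.res.X P).L8 (θ.res.X P).C₂ (θ.res.X P).B₁' (θ.res.X P).B₀' (θ.res.X P).B₁ (θ.res.X P).B₂ (θ.res.X P).c₁
        (θ.res.X P).inp8 (θ.res.X P).B₀β (θ.res.X P).loc8 (θ.res.X P).fam8R (θ.res.X P).lan8 (θ.res.X P).cub8 (θ.res.X P).toAxial8)
    (h06 : ∀ P : B12.RunParams, B9LeafX (θ.res.Y P))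
    (h07 : ∀ P : B12.RunParams, B11Leaf (θ.res.Z P))
    (h08 : ∀ P : B12.RunParams, ∃ (Xc : PrintedCarriersR) (I : Type) (C : B10Assembly.Consts) (T : I → B10.TowerRun),
      Nonempty (∀ i, B10Assembly.LeafSystem C (T i)) ∧ θ.res.X P = Xc.withTowerRuns10 T)
    (h09 : ∀ P : B12.RunParams, B12Sec2to5.Lemma4Printed (θ.res.X P).F12 (θ.res.X P).c12)
    (h09T : ∀ P : B12.RunParams, (leavesP w P).smallCouplings → (leavesP w P).smallFieldInductive)
    (h10 : ∀ P : B12.RunParams, B9LeafX (θ.res.Y P) →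
      (B10.Thm1PrintedCompact (θ.res.X P).runs10 ∧ B10.Thm2Printed (θ.res.X P).runs10) →
        B11Leaf (θ.res.Z P) → B12Sec2to5.Lemma4Printed (θ.res.X P).F12 (θ.res.X P).c12 →
          B13.Lemma1Printed (θ.res.X P).S13 (θ.res.X P).c13 ∧ B13.Lemma2Printed (θ.res.X P).S13 (θ.res.X P).c13 ∧
            B13.Lemma3Printed (θ.res.X P).S13 (θ.res.X P).c13)
    (h11 : ∀ P : B12.RunParams, (leavesP w P).b7 → (leavesP w P).b8 → (leavesP w P).b9 → (leavesP w P).b10 → (leavesP w P).b11 →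
      (leavesP w P).smallCouplings → (leavesP w P).smallFieldInductive → (leavesP w P).flowControl →
        ∀ k, k < P.K → SLaw₁₃CoPR F N θ P k → TLaw₁₃CoPR F N θ P k)
    (h12 : ∀ P : B12.RunParams, B15Leaf (θ.res.W P))
    (hUV : ∀ P : B12.RunParams, (genFlow (betaOfRecord₁₃ F N θ.toStage13Params) P.g0).InInterval w.γ P.K → ∀ k, k ≤ P.K → SLaw₁₃CoPR F N θ P k →
      ∀ U : GaugeField (F.P P.K) k (SU N),
        chiβOfRecord₁₃ F N θ.toStage13Params P.K (gOfRecord₁₃ F N θ.toStage13Params P) k U *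
              Real.exp (-(1 / (gOfRecord₁₃ F N θ.toStage13Params P k) ^ 2 * wilsonBGOfRecord F N θ.εbg P k U)
                - w.em (gOfRecord₁₃ F N θ.toStage13Params P k) * (Fintype.card (Site (F.P P.K) k) : ℝ)) ≤ densOfRecord₁₃ F N θ.toStage13Params P k U ∧
        densOfRecord₁₃ F N θ.toStage13Params P k U ≤ Real.exp (w.ep (gOfRecord₁₃ F N θ.toStage13Params P k) * (Fintype.card (Site (F.P P.K) k) : ℝ)))
    (hlo : BetaLowerH w.b w.γ (datumOfRecord₁₃CoPR F N θ hP).βfun) (hhi : BetaUpperH w.βup w.γ (datumOfRecord₁₃CoPR F N θ hP).βfun) :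
    B16.EndStatementBPrinted (datumOfRecord₁₃CoPR F N θ hP).C :=
  N24_endStatementBPrinted₁₃CoPR_pointed θ hP hθ w hC hγ hL hup h05 h06 h07 h08 h09 h09T h10 h11 h12 (fun P k hk => laws₁₃CoPR_of_liveSel_of_rstep F N θ P (fun p k _ hk => hP.rstep p k hk) hθ hκ hE₀ hB₀ hsel k hk) hUV hlo hhi

/-- **THE K1-CLASS ₁₃ ITEM's (D, w)-CONSEQUENT WITNESSED BY THE PRESENTATION AND THE BOUND WORLD ON THE LIVE-SELECTOR LINE** — `IsRecordOfRecord₁₃CCoPR … w ∧ (B) ∧ window` with N13's (R₁₃) DISCHARGED BY NAME (the window from `hhi` alone).  COMPOSITE: nothing is discharged as a node. [cite: Balaban1989LargeFieldII, Thm 1 p.355 + p.391; Balaban1988Convergent, p.244, Thm 2 p.263; Balaban1989LargeFieldI, (0.3) p.176; Balaban1987RG1, (0.17)–(0.20) pp.255–256 and (1.22) p.264 (bookkeeping + elementary window)] -/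
theorem N24_stabilityBR13CoPR_shape_pointed_liveSel (θ : Stage13RParams F N) (hP : θ.Provisos₁₃CoPR F N) (hθ : θ.Admissible F N)
    (hκ : 0 ≤ θ.s2.lf.κ) (hE₀ : 0 ≤ θ.s2.lf.E₀) (hB₀ : 0 ≤ θ.s2.lf.B₀)
    (hsel : θ.ppSel = ppSelLiveOfRecord F N θ.ν θ.τ9 (EOfRecord₁₃ F N θ.toStage13Params) (wOfRecord₉ F N θ.toStage9Params)) (w : WorldP)
    (hC : w.C = (datumOfRecord₁₃CoPR F N θ hP).C) (hγ : 0 < w.γ ∧ w.γ ≤ θ.γ) (hL : w.L = (θ.L : ℝ))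
    (hup : ∀ P, w.up P = upOfRecord₅C F N (θ.toStage5₁₃CoPR F N) P)
    (h05 : ∀ P : B12.RunParams,
      B8LeafR (θ.res.X P).d8 (θ.res.X P).L8 (θ.res.X P).C₂ (θ.res.X P).B₁' (θ.res.X P).B₀' (θ.res.X P).B₁ (θ.res.X P).B₂ (θ.res.X P).c₁
        (θ.res.X P).inp8 (θ.res.X P).B₀β (θ.res.X P).loc8 (θ.res.X P).fam8R (θ.res.X P).lan8 (θ.res.X P).cub8 (θ.res.X P).toAxial8)
    (h06 : ∀ P : B12.RunParams, B9LeafX (θ.res.Y P))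
    (h07 : ∀ P : B12.RunParams, B11Leaf (θ.res.Z P))
    (h08 : ∀ P : B12.RunParams, ∃ (Xc : PrintedCarriersR) (I : Type) (C : B10Assembly.Consts) (T : I → B10.TowerRun),
      Nonempty (∀ i, B10Assembly.LeafSystem C (T i)) ∧ θ.res.X P = Xc.withTowerRuns10 T)
    (h09 : ∀ P : B12.RunParams, B12Sec2to5.Lemma4Printed (θ.res.X P).F12 (θ.res.X P).c12)
    (h09T : ∀ P : B12.RunParams, (leavesP w P).smallCouplings → (leavesP w P).smallFieldInductive)
    (h10 : ∀ P : B12.RunParams, B9LeafX (θ.res.Y P) →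
      (B10.Thm1PrintedCompact (θ.res.X P).runs10 ∧ B10.Thm2Printed (θ.res.X P).runs10) →
        B11Leaf (θ.res.Z P) → B12Sec2to5.Lemma4Printed (θ.res.X P).F12 (θ.res.X P).c12 →
          B13.Lemma1Printed (θ.res.X P).S13 (θ.res.X P).c13 ∧ B13.Lemma2Printed (θ.res.X P).S13 (θ.res.X P).c13 ∧
            B13.Lemma3Printed (θ.res.X P).S13 (θ.res.X P).c13)
    (h11 : ∀ P : B12.RunParams, (leavesP w P).b7 → (leavesP w P).b8 → (leavesP w P).b9 → (leavesP w P).b10 → (leavesP w P).b11 →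
      (leavesP w P).smallCouplings → (leavesP w P).smallFieldInductive → (leavesP w P).flowControl →
        ∀ k, k < P.K → SLaw₁₃CoPR F N θ P k → TLaw₁₃CoPR F N θ P k)
    (h12 : ∀ P : B12.RunParams, B15Leaf (θ.res.W P))
    (hUV : ∀ P : B12.RunParams, (genFlow (betaOfRecord₁₃ F N θ.toStage13Params) P.g0).InInterval w.γ P.K → ∀ k, k ≤ P.K → SLaw₁₃CoPR F N θ P k →
      ∀ U : GaugeField (F.P P.K) k (SU N),
        chiβOfRecord₁₃ F N θ.toStage13Params P.K (gOfRecord₁₃ F N θ.toStage13Params P) k U *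
              Real.exp (-(1 / (gOfRecord₁₃ F N θ.toStage13Params P k) ^ 2 * wilsonBGOfRecord F N θ.εbg P k U)
                - w.em (gOfRecord₁₃ F N θ.toStage13Params P k) * (Fintype.card (Site (F.P P.K) k) : ℝ)) ≤ densOfRecord₁₃ F N θ.toStage13Params P k U ∧
        densOfRecord₁₃ F N θ.toStage13Params P k U ≤ Real.exp (w.ep (gOfRecord₁₃ F N θ.toStage13Params P k) * (Fintype.card (Site (F.P P.K) k) : ℝ)))
    (hlo : BetaLowerH w.b w.γ (datumOfRecord₁₃CoPR F N θ hP).βfun) (hhi : BetaUpperH w.βup w.γ (datumOfRecord₁₃CoPR F N θ hP).βfun) :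
    IsRecordOfRecord₁₃CCoPR F N (datumOfRecord₁₃CoPR F N θ hP) w ∧ B16.EndStatementBPrinted (datumOfRecord₁₃CoPR F N θ hP).C ∧
      ∃ γ₁ : ℝ, 0 < γ₁ ∧ ∀ γ : ℝ, 0 < γ → γ ≤ γ₁ → ∃ P : B12.RunParams, 1 ≤ P.K ∧ ((datumOfRecord₁₃CoPR F N θ hP).C P).flow.InInterval γ P.K :=
  N24_stabilityBR13CoPR_shape_pointed θ hP hθ w hC hγ hL hup h05 h06 h07 h08 h09 h09T h10 h11 h12 (fun P k hk => laws₁₃CoPR_of_liveSel_of_rstep F N θ P (fun p k _ hk => hP.rstep p k hk) hθ hκ hE₀ hB₀ hsel k hk) hUV hlo hhi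

/-! ## §2. At node00-def-K0a's live re-pin `θ.liveRepin₁₃` (the selector clause holds by `rfl`) -/

/-- **★ THE K1-CLASS ₁₃ ITEM's (D, w)-CONSEQUENT WITNESSED BY A LIVE RE-PIN `(θ.liveRepin₁₃, hP)`** — §1 at `θ.liveRepin₁₃` with the selector clause DISCHARGED by K0a's `liveRepin₁₃_ppSel` (`rfl`) and `Admissible` by `Admissible.liveRepin₁₃`.  WHICH CHILD BLOCKS ON THE STAGE-13 LIVE LINE = this hypothesis list: `hP` (provisos AT THE RE-PIN = K0″'s residual), `θ`'s signs, the world binding, N05 ∕ N06 ∕ N07 ∕ N08 ∕ N12 leaves at the re-pin's residual groups (= `θ`'s), N09's own leaf + Thm-3 member, N10's socket, N11's (S1ᵀ), N13's (UV₁₃), the β-box pair.  COMPOSITE: nothing is discharged as a node. [cite: Balaban1989LargeFieldII, Thm 1 p.355, (0.1) pp.355–356, p.391; Balaban1988Convergent, p.244, Thm 2 p.263, (3.22) p.269; Balaban1989LargeFieldI, (0.3)–(0.4) p.176; Balaban1987RG1, Thm 3 p.264, (0.17)–(0.21) pp.255–256 and (1.22) p.264 (bookkeeping + elementary window)] -/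
theorem N24_stabilityBR13CoPR_shape_pointed_liveRepin₁₃ (θ : Stage13Params F N) (Zr : (q : B12.RunParams) → TkResidualW F N (FluctV N) q.K) (hP : (⟨θ.liveRepin₁₃ F N, Zr⟩ : Stage13RParams F N).Provisos₁₃CoPR F N) (hθ : θ.Admissible F N)
    (hκ : 0 ≤ θ.s2.lf.κ) (hE₀ : 0 ≤ θ.s2.lf.E₀) (hB₀ : 0 ≤ θ.s2.lf.B₀) (w : WorldP)
    (hC : w.C = (datumOfRecord₁₃CoPR F N (⟨θ.liveRepin₁₃ F N, Zr⟩ : Stage13RParams F N) hP).C) (hγ : 0 < w.γ ∧ w.γ ≤ (θ.liveRepin₁₃ F N).γ) (hL : w.L = ((θ.liveRepin₁₃ F N).L : ℝ))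
    (hup : ∀ P, w.up P = upOfRecord₅C F N ((⟨θ.liveRepin₁₃ F N, Zr⟩ : Stage13RParams F N).toStage5₁₃CoPR F N) P)
    (h05 : ∀ P : B12.RunParams,
      B8LeafR ((θ.liveRepin₁₃ F N).res.X P).d8 ((θ.liveRepin₁₃ F N).res.X P).L8 ((θ.liveRepin₁₃ F N).res.X P).C₂ ((θ.liveRepin₁₃ F N).res.X P).B₁' ((θ.liveRepin₁₃ F N).res.X P).B₀' ((θ.liveRepin₁₃ F N).res.X P).B₁ ((θ.liveRepin₁₃ F N).res.X P).B₂ ((θ.liveRepin₁₃ F N).res.X P).c₁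
        ((θ.liveRepin₁₃ F N).res.X P).inp8 ((θ.liveRepin₁₃ F N).res.X P).B₀β ((θ.liveRepin₁₃ F N).res.X P).loc8 ((θ.liveRepin₁₃ F N).res.X P).fam8R ((θ.liveRepin₁₃ F N).res.X P).lan8 ((θ.liveRepin₁₃ F N).res.X P).cub8 ((θ.liveRepin₁₃ F N).res.X P).toAxial8)
    (h06 : ∀ P : B12.RunParams, B9LeafX ((θ.liveRepin₁₃ F N).res.Y P))
    (h07 : ∀ P : B12.RunParams, B11Leaf ((θ.liveRepin₁₃ F N).res.Z P))
    (h08 : ∀ P : B12.RunParams, ∃ (Xc : PrintedCarriersR) (I : Type) (C : B10Assembly.Consts) (T : I → B10.TowerRun),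
      Nonempty (∀ i, B10Assembly.LeafSystem C (T i)) ∧ (θ.liveRepin₁₃ F N).res.X P = Xc.withTowerRuns10 T)
    (h09 : ∀ P : B12.RunParams, B12Sec2to5.Lemma4Printed ((θ.liveRepin₁₃ F N).res.X P).F12 ((θ.liveRepin₁₃ F N).res.X P).c12)
    (h09T : ∀ P : B12.RunParams, (leavesP w P).smallCouplings → (leavesP w P).smallFieldInductive)
    (h10 : ∀ P : B12.RunParams, B9LeafX ((θ.liveRepin₁₃ F N).res.Y P) →
      (B10.Thm1PrintedCompact ((θ.liveRepin₁₃ F N).res.X P).runs10 ∧ B10.Thm2Printed ((θ.liveRepin₁₃ F N).res.X P).runs10) →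
        B11Leaf ((θ.liveRepin₁₃ F N).res.Z P) → B12Sec2to5.Lemma4Printed ((θ.liveRepin₁₃ F N).res.X P).F12 ((θ.liveRepin₁₃ F N).res.X P).c12 →
          B13.Lemma1Printed ((θ.liveRepin₁₃ F N).res.X P).S13 ((θ.liveRepin₁₃ F N).res.X P).c13 ∧ B13.Lemma2Printed ((θ.liveRepin₁₃ F N).res.X P).S13 ((θ.liveRepin₁₃ F N).res.X P).c13 ∧
            B13.Lemma3Printed ((θ.liveRepin₁₃ F N).res.X P).S13 ((θ.liveRepin₁₃ F N).res.X P).c13)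
    (h11 : ∀ P : B12.RunParams, (leavesP w P).b7 → (leavesP w P).b8 → (leavesP w P).b9 → (leavesP w P).b10 → (leavesP w P).b11 →
      (leavesP w P).smallCouplings → (leavesP w P).smallFieldInductive → (leavesP w P).flowControl →
        ∀ k, k < P.K → SLaw₁₃CoPR F N (⟨θ.liveRepin₁₃ F N, Zr⟩ : Stage13RParams F N) P k → TLaw₁₃CoPR F N (⟨θ.liveRepin₁₃ F N, Zr⟩ : Stage13RParams F N) P k)
    (h12 : ∀ P : B12.RunParams, B15Leaf ((θ.liveRepin₁₃ F N).res.W P))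
    (hUV : ∀ P : B12.RunParams, (genFlow (betaOfRecord₁₃ F N (θ.liveRepin₁₃ F N)) P.g0).InInterval w.γ P.K → ∀ k, k ≤ P.K → SLaw₁₃CoPR F N (⟨θ.liveRepin₁₃ F N, Zr⟩ : Stage13RParams F N) P k →
      ∀ U : GaugeField (F.P P.K) k (SU N),
        chiβOfRecord₁₃ F N (θ.liveRepin₁₃ F N) P.K (gOfRecord₁₃ F N (θ.liveRepin₁₃ F N) P) k U *
              Real.exp (-(1 / (gOfRecord₁₃ F N (θ.liveRepin₁₃ F N) P k) ^ 2 * wilsonBGOfRecord F N (θ.liveRepin₁₃ F N).εbg P k U)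
                - w.em (gOfRecord₁₃ F N (θ.liveRepin₁₃ F N) P k) * (Fintype.card (Site (F.P P.K) k) : ℝ)) ≤ densOfRecord₁₃ F N (θ.liveRepin₁₃ F N) P k U ∧
        densOfRecord₁₃ F N (θ.liveRepin₁₃ F N) P k U ≤ Real.exp (w.ep (gOfRecord₁₃ F N (θ.liveRepin₁₃ F N) P k) * (Fintype.card (Site (F.P P.K) k) : ℝ)))
    (hlo : BetaLowerH w.b w.γ (datumOfRecord₁₃CoPR F N (⟨θ.liveRepin₁₃ F N, Zr⟩ : Stage13RParams F N) hP).βfun) (hhi : BetaUpperH w.βup w.γ (datumOfRecord₁₃CoPR F N (⟨θ.liveRepin₁₃ F N, Zr⟩ : Stage13RParams F N) hP).βfun) :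
    IsRecordOfRecord₁₃CCoPR F N (datumOfRecord₁₃CoPR F N (⟨θ.liveRepin₁₃ F N, Zr⟩ : Stage13RParams F N) hP) w ∧ B16.EndStatementBPrinted (datumOfRecord₁₃CoPR F N (⟨θ.liveRepin₁₃ F N, Zr⟩ : Stage13RParams F N) hP).C ∧
      ∃ γ₁ : ℝ, 0 < γ₁ ∧ ∀ γ : ℝ, 0 < γ → γ ≤ γ₁ → ∃ P : B12.RunParams, 1 ≤ P.K ∧ ((datumOfRecord₁₃CoPR F N (⟨θ.liveRepin₁₃ F N, Zr⟩ : Stage13RParams F N) hP).C P).flow.InInterval γ P.K :=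
  N24_stabilityBR13CoPR_shape_pointed_liveSel (⟨θ.liveRepin₁₃ F N, Zr⟩ : Stage13RParams F N) hP hθ.liveRepin₁₃ hκ hE₀ hB₀ (Stage13Params.liveRepin₁₃_ppSel F N θ)
    w hC hγ hL hup h05 h06 h07 h08 h09 h09T h10 h11 h12 hUV hlo hhi

end Literature.MathematicalPhysics.QuantumFieldTheory.Balaban1983to89.Node00

end
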